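import Mathlib
import HarnessLib

/-!
# Crux `MazurMCOnX1RankZero` (route `EisensteinPrimes`, rung K5, item stmt-BirchSwinnertonDyer-19035):
# the ORDER-ZERO SEAM of the tame Stickelberger element — `θ_q(𝟙) = χ_𝔮(p)`

HONEST FRAMING (cell `bsd-eis`, seat `bsd-eis-k5-c5` gen 4). THEOREMS ONLY, over Mathlib; nothing
about elliptic curves is asserted and nothing is closed or booked. Context: the crux idea card
`trifkovic-gram-series-reciprocity` (ideation seat `bsd-eis-idea` g0, 2026-08-27; HOME/idea-g0/,
LENS MEMO §2/§5) defines, for a prime `q ≡ 1 (mod p)` with `k := v_p(q−1) − 1`, the TAME STICKELBERGER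
ELEMENT `θ_q := Σ_{σ ∈ Γ_k} χ_𝔮(σ·π_k)·σ ∈ 𝔽_p[Γ_k]`, `π_k := N_{ℚ(ζ_{p^{k+1}})/K_k}(1 − ζ_{p^{k+1}})`,
`χ_𝔮` the `p`-th power residue character at a prime `𝔮 ∣ q`, and conjectures (ER_p) that the μ-stripped
mod-`p` plus `p`-adic `L`-function of the level-`q` Eisenstein family is `θ_q·θ_q^ι` (verified 67/67
classes, 294/294 coefficients at `p ∈ {3,5}`). Its memo §5 records the SEAM with print at order `T⁰`:
"`θ_q(0) = Σ_j c_j = χ_𝔮(∏_σ σπ_k) = χ_𝔮(N_{ℚ(ζ_{p^{k+1}})/ℚ}(1 − ζ)) = χ_𝔮(p)`, so (ER_p) mod `T` is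
LITERALLY Pollack–Wake 2025 Thm. 1.2's criterion («`p` not a `p`-th power mod `N` ⟹ `λ = 0`»), for every
`k`". This file proves that seam as a statement of cyclotomic arithmetic in the residue field: in any
domain `F` holding a primitive `p^{k+1}`-th root of unity (e.g. `F = 𝔽_q = 𝒪_{K_k}/𝔮`, where the
Galois conjugates `σ(1 − ζ)` reduce to `1 − μ` over ALL primitive `p^{k+1}`-th roots `μ ∈ F`),

  `∏_{μ primitive p^{k+1}-th root in F} (1 − μ) = p`        (= `Φ_{p^{k+1}}(1)`),

hence for every multiplicative character `χ` of `F` (in particular the `p`-th power residue symbol)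
`∏_μ χ(1 − μ) = χ(p)` — additively: the augmentation of `θ_q` is `χ_𝔮(p)`, which vanishes iff `p` is
a `p`-th power modulo `q`. (That the `σ·π_k`, `σ ∈ Γ_k`, reduce modulo `𝔮` to the products of `1 − μ`
over the `p − 1` primitive roots `μ` in each coset is the definition of `π_k` as a partial norm; the
product over ALL of `Gal(ℚ(ζ_{p^{k+1}})/ℚ)` is what is computed here.)

* §1 `prod_one_sub_primitiveRoots_prime_pow` — the product identity (Mathlib:
  `Polynomial.cyclotomic_eq_prod_X_sub_primitiveRoots`, `Polynomial.eval_one_cyclotomic_prime_pow`).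
* §2 `prod_map_one_sub_primitiveRoots_prime_pow` — the character form (`map_prod`);
  `one_sub_ne_zero_of_mem_primitiveRoots` (each factor is non-zero, so a character of `Fˣ` applies).
* §3 `zmod_exists_isPrimitiveRoot_prime_pow_of_dvd` — in `𝔽_q` with `p^{k+1} ∣ q − 1` a primitive
  `p^{k+1}`-th root of unity exists (cyclicity of `𝔽_qˣ`), so §1–§2 apply to `F = ZMod q`:
  `zmod_prod_one_sub_primitiveRoots_prime_pow` (+ `zmod_card_primitiveRoots_prime_pow`).

References: HOME/idea-g0/LENS-MEMO-idea-g0.md §2, §5 (seam); [cite: PollackWake2025, Thm. 1.2]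
[cite: Trifkovic2005, Thm. 4 and §9] [cite: Washington1997, Lemma 1.4 / Prop. 2.8 (Φ_{p^n}(1) = p; 1 − ζ generates the prime above p)]
-/

set_option linter.dupNamespace false
set_option autoImplicit false

open Polynomial Finset

namespace Summit.BirchSwinnertonDyer.BirchSwinnertonDyer.Theorems.EisensteinPrimesMazurMCOnX1RankZeroTameSeam

/-! ## §1. `∏_{μ primitive} (1 − μ) = p` -/

/-- **`Φ_{p^{k+1}}(1) = p` split into linear factors**: in a domain `F` with a primitive `p^{k+1}`-th
root of unity, `∏_{μ ∈ primitiveRoots (p^{k+1}) F} (1 − μ) = p`. Proof: evaluate Mathlib's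
`cyclotomic (p^(k+1)) F = ∏ (X − C μ)` at `1` and use `eval 1 (cyclotomic (p^(k+1)) F) = p`.
[cite: Washington1997, Lemma 1.4 / Prop. 2.8] -/
theorem prod_one_sub_primitiveRoots_prime_pow {F : Type*} [CommRing F] [IsDomain F] {p : ℕ}
    [hp : Fact p.Prime] (k : ℕ) {ζ : F} (hζ : IsPrimitiveRoot ζ (p ^ (k + 1))) :
    ∏ μ ∈ primitiveRoots (p ^ (k + 1)) F, (1 - μ) = (p : F) := by
  have h := congrArg (Polynomial.eval (1 : F)) (cyclotomic_eq_prod_X_sub_primitiveRoots hζ)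
  rw [eval_one_cyclotomic_prime_pow k, eval_prod] at h
  simp only [eval_sub, eval_X, eval_C] at h
  exact h.symm

/-! ## §2. The character form: `∏_μ χ(1 − μ) = χ(p)` -/

/-- Each factor `1 − μ` is non-zero: a primitive `p^{k+1}`-th root of unity is `≠ 1` since `p^{k+1} > 1`.
[folklore] -/
theorem one_sub_ne_zero_of_mem_primitiveRoots {F : Type*} [CommRing F] [IsDomain F] {p : ℕ}
    [hp : Fact p.Prime] (k : ℕ) {μ : F} (hμ : μ ∈ primitiveRoots (p ^ (k + 1)) F) : 1 - μ ≠ 0 := by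
  have hpk : 1 < p ^ (k + 1) := Nat.one_lt_pow (Nat.succ_ne_zero k) hp.out.one_lt
  have hμ' : IsPrimitiveRoot μ (p ^ (k + 1)) := (mem_primitiveRoots (by omega)).mp hμ
  intro h
  have hμ1 : μ = 1 := (sub_eq_zero.mp h).symm
  have h1 := hμ'.eq_orderOf
  rw [hμ1, orderOf_one] at h1
  omega

/-- **The seam, multiplicative form**: for any monoid homomorphism `χ` out of `F` (e.g. a power-residue
character extended by anything at `0` — the factors are non-zero by
`one_sub_ne_zero_of_mem_primitiveRoots`), `∏_{μ primitive} χ(1 − μ) = χ(p)`. With `χ = χ_𝔮` the `p`-th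
power residue symbol of `𝔽_q` read additively this is `θ_q(𝟙) = χ_𝔮(p)`: the augmentation of the tame
Stickelberger element vanishes iff `p` is a `p`-th power mod `q` — Pollack–Wake's criterion.
[cite: PollackWake2025, Thm. 1.2] [cite: Trifkovic2005, Thm. 4 and §9] -/
theorem prod_map_one_sub_primitiveRoots_prime_pow {F M : Type*} [CommRing F] [IsDomain F]
    [CommMonoid M] {p : ℕ} [hp : Fact p.Prime] (k : ℕ) {ζ : F} (hζ : IsPrimitiveRoot ζ (p ^ (k + 1)))
    (χ : F →* M) : ∏ μ ∈ primitiveRoots (p ^ (k + 1)) F, χ (1 - μ) = χ (p : F) := by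
  rw [← map_prod, prod_one_sub_primitiveRoots_prime_pow k hζ]

/-- **The seam for a character of the unit group** `χ : Fˣ →* M` (the honest home of a power-residue
symbol), the factors being lifted to units by §2's non-vanishing: `∏_μ χ(unit(1 − μ)) = χ(unit(p))`
whenever `(p : F) ≠ 0` (i.e. `char F ≠ p`; for `F = 𝔽_q` this is `q ≠ p`, automatic when
`p^{k+1} ∣ q − 1`). [cite: PollackWake2025, Thm. 1.2] -/
theorem prod_map_units_one_sub_primitiveRoots_prime_pow {F M : Type*} [Field F] [CommMonoid M]
    {p : ℕ} [hp : Fact p.Prime] (k : ℕ) {ζ : F} (hζ : IsPrimitiveRoot ζ (p ^ (k + 1)))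
    (χ : Fˣ →* M) (hpF : (p : F) ≠ 0) :
    ∏ μ ∈ (primitiveRoots (p ^ (k + 1)) F).attach,
        χ (Units.mk0 (1 - (μ : F)) (one_sub_ne_zero_of_mem_primitiveRoots k μ.2)) =
      χ (Units.mk0 (p : F) hpF) := by
  rw [← map_prod]
  congr 1
  ext
  rw [Units.val_mk0, Units.coe_prod]
  simp only [Units.val_mk0]
  rw [prod_attach (primitiveRoots (p ^ (k + 1)) F) (fun μ ↦ (1 - μ))]
  exact prod_one_sub_primitiveRoots_prime_pow k hζ

/-! ## §3. The residue field `𝔽_q`, `p^{k+1} ∣ q − 1` -/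

/-- In `𝔽_q` (`q` prime) with `p^{k+1} ∣ q − 1` there is a primitive `p^{k+1}`-th root of unity
(`𝔽_qˣ` is cyclic of order `q − 1`). [folklore] -/
theorem zmod_exists_isPrimitiveRoot_prime_pow_of_dvd {q p : ℕ} [hq : Fact q.Prime] (k : ℕ)
    (hdvd : p ^ (k + 1) ∣ q - 1) : ∃ ζ : ZMod q, IsPrimitiveRoot ζ (p ^ (k + 1)) := by
  have hcard : p ^ (k + 1) ∣ Fintype.card (ZMod q)ˣ := by rwa [ZMod.card_units_eq_totient, Nat.totient_prime hq.out]
  have hpos : 0 < p ^ (k + 1) := Nat.pos_of_ne_zero fun h ↦ by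
    rw [h, zero_dvd_iff] at hcard; exact Fintype.card_ne_zero hcard
  have hcount := IsCyclic.card_orderOf_eq_totient hcard
  have hne : (Finset.univ.filter fun a : (ZMod q)ˣ ↦ orderOf a = p ^ (k + 1)).Nonempty := by
    rw [← Finset.card_pos, hcount]
    exact Nat.totient_pos.mpr hpos
  obtain ⟨g, hg⟩ := hne
  rw [Finset.mem_filter] at hg
  exact ⟨(g : ZMod q), IsPrimitiveRoot.coe_units_iff.mpr (IsPrimitiveRoot.iff_orderOf.mpr hg.2)⟩

/-- **The seam in `𝔽_q`**: for primes `p`, `q` with `p^{k+1} ∣ q − 1`,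
`∏_{μ ∈ primitiveRoots (p^{k+1}) 𝔽_q} (1 − μ) = p` in `𝔽_q` — the reduction modulo a prime `𝔮 ∣ q` of
`N_{ℚ(ζ_{p^{k+1}})/ℚ}(1 − ζ) = p`, i.e. `θ_q(𝟙) = χ_𝔮(p)` for the tame Stickelberger element of the card
`trifkovic-gram-series-reciprocity`. [cite: PollackWake2025, Thm. 1.2] [cite: Washington1997, Lemma 1.4 / Prop. 2.8] -/
theorem zmod_prod_one_sub_primitiveRoots_prime_pow {q p : ℕ} [hq : Fact q.Prime] [hp : Fact p.Prime]
    (k : ℕ) (hdvd : p ^ (k + 1) ∣ q - 1) :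
    ∏ μ ∈ primitiveRoots (p ^ (k + 1)) (ZMod q), (1 - μ) = (p : ZMod q) := by
  obtain ⟨ζ, hζ⟩ := zmod_exists_isPrimitiveRoot_prime_pow_of_dvd (q := q) (p := p) k hdvd
  exact prod_one_sub_primitiveRoots_prime_pow k hζ

/-- … and the number of factors is `φ(p^{k+1}) = #Gal(ℚ(ζ_{p^{k+1}})/ℚ)` (= `(p − 1)·#Γ_k`, the `p − 1`
primitive roots per coset times the `p^k` elements of `Γ_k`). [folklore] -/
theorem zmod_card_primitiveRoots_prime_pow {q p : ℕ} [hq : Fact q.Prime] (k : ℕ) (hdvd : p ^ (k + 1) ∣ q - 1) :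
    (primitiveRoots (p ^ (k + 1)) (ZMod q)).card = Nat.totient (p ^ (k + 1)) := by
  obtain ⟨ζ, hζ⟩ := zmod_exists_isPrimitiveRoot_prime_pow_of_dvd (q := q) (p := p) k hdvd
  exact hζ.card_primitiveRoots

end Summit.BirchSwinnertonDyer.BirchSwinnertonDyer.Theorems.EisensteinPrimesMazurMCOnX1RankZeroTameSeam
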